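import Summits.BirchSwinnertonDyer.BirchSwinnertonDyer.Theses.KatoDescentTamePotSupersingular
import Summits.BirchSwinnertonDyer.Rank1Residual.O6.PotGoodOfHullKMC
import HarnessLib

/-!
# Route `KatoDescentTamePotSupersingular` (rung K8, sub-rung B4 (t′), cell `bsd-potss`): the crux
# `TameLowerHalfRankZero` (L₀, item stmt-BirchSwinnertonDyer-19981) FROM KMC_p IN HULL CURRENCY — no
# torsion-free member, no Mazur–Kenku walk (a `--supports … --as helper` file)

Twin of `KatoDescentPotSupersingularWildLowerHalfOfHullKMC.lean` at a general odd tame potentially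
supersingular prime, alongside k8t-c2's torsion-free glue (`…TameLowerHalfOfKMC.lean`): the exact rank-`0`
count at a hull-realised member (seat kmc part 14, p419205) gives `KMC_p(W') ⟹ BSD_p(W')` at ANY member,
then Cassels; the (t′) rows are a slice of the uniform node (`ClassO5.padicValRat_j_nonneg`). Over Reading
M1♯ (`KatoHull.Realizable`), Reading M3♯ (`KatoHull.ExactCountReading`), the interface lemma
`KatoHull.ReadsKMC`, Cassels / GZK / modularity, and KMC_p at the additive potentially good curves of
analytic rank `0`. CONDITIONAL (audit `proof.conditional`); nothing about Kato's objects or his Main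
Conjecture is asserted; the item is NOT closed. Seat `bsd-potss-kmc` generation 7.

References: [Kato2004Asterisque] Conj. 12.10 (p. 224), §14.14 (p. 243), Prop. 14.16 (2) (p. 244);
[Cassels1965ArithmeticVIII]; [Miller2011LMS] Def. 1.1.
-/

set_option autoImplicit false
-- sibling precedent (`KatoDescentTamePotSupersingularAssembly.lean`): the directory name repeats the summit name
set_option linter.dupNamespace false

noncomputable section

open scoped Classical

namespace Summit.BirchSwinnertonDyer.BirchSwinnertonDyer.Theorems

open WeierstrassCurve Literature.NumberTheory.EllipticCurves
  Literature.NumberTheory.EllipticCurves.Rank1Residual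
  Literature.NumberTheory.EllipticCurves.Rank1Residual.Typed
  Summit.BirchSwinnertonDyer.Rank1Residual.Additive
  Summit.BirchSwinnertonDyer.Rank1Residual
  Summit.BirchSwinnertonDyer.BirchSwinnertonDyer.Theses.KatoDescentTamePotSupersingular

variable {IsHullOf : ∀ (W : WeierstrassCurve ℚ) [W.IsElliptic] [W.IsGloballyMinimal] (p : ℕ)
  [Fact p.Prime], KatoHullDescentDatum p → Prop}
variable {KMC : ∀ (W : WeierstrassCurve ℚ) [W.IsElliptic] [W.IsGloballyMinimal] (p : ℕ), Prop}

/-- **DescentGlue for the crux `TameLowerHalfRankZero` in hull currency: KMC_p at the additive potentially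
good curves of analytic rank `0` ⟹ the (t′) lower half**, over Reading M1♯, Reading M3♯, `ReadsKMC`, and
Cassels / GZK / modularity — by `O6.tameLowerHalfRankZero_of_hullKMC` (type = the route decl verbatim).
Conditional over displayed hypotheses; nothing about Kato's objects is asserted; the item is not closed.
[cite: Kato2004Asterisque, Conj. 12.10 (p. 224), §14.14 (p. 243), Prop. 14.16 (2) (p. 244)] [cite: Cassels1965ArithmeticVIII] -/
theorem tameLowerHalfRankZero_of_hullKMC (hRz : KatoHull.Realizable IsHullOf)
    (hC : KatoHull.ExactCountReading IsHullOf) (hK : KatoHull.ReadsKMC IsHullOf KMC)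
    (hCassels : bsdRHS_eq_of_isIsogenous) (hGZK : rank_eq_analyticRank_of_analyticRank_le_one)
    (hmod : hasEntireLFunction_rat)
    (hKMC : ∀ (W : WeierstrassCurve ℚ) [W.IsElliptic] [W.IsGloballyMinimal] (p : ℕ) [Fact p.Prime],
      W.analyticRank = 0 → p ≠ 2 → Addv W p → 0 ≤ padicValRat p W.j → KMC W p) :
    Summit.BirchSwinnertonDyer.BirchSwinnertonDyer.Theses.KatoDescentTamePotSupersingular.TameLowerHalfRankZero :=
  fun W _ _ p _ hr hp hadd hT ↦
    O6.tameLowerHalfRankZero_of_hullKMC hRz hC hK hCassels hGZK hmod hKMC W p hr hp hadd hT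

end Summit.BirchSwinnertonDyer.BirchSwinnertonDyer.Theorems

end
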